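import Literature.AlgebraicGeometry.AbelianSchemes.AbelianSchemeMulNPullbackClass
import Literature.AlgebraicGeometry.AbelianVarieties.LineBundleTensorPower
import Literature.AlgebraicGeometry.Modules.DetClassOfIso
import HarnessLib

/-!
# Pull-back of a (symmetric) line bundle along a torsion section of an abelian scheme:
# `(σ^*L)^{⊗N²} ≅ (e^*L)^{⊗N²}` (Mumford §6 Cor. 3 read at an `N`-torsion point; the input of MFK Ch. 7 §3)

Layer `Literature/AlgebraicGeometry/AbelianSchemes`, namespace `Literature.AlgebraicGeometry.AbelianSchemes.AbelianSchemeOver`.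
THEOREMS ONLY (no definition, no named fact, no instance, no notation, no `sorry`).  Cell `hodgecm-mathlib` (D-0151),
F-DAG row F-9 (quasi-projectivity of the Siegel moduli scheme, road Q2 «intrinsic bundles»), brick (G2) of the census
`B-provers/B-p06/g13/CENSUS-F9-QuasiProjectivity.B-p06g13.md` §2 (author A-p14 (g12), A hand on loan s240).  HC_CM is proved
only modulo the 7 printed citations until rung 0 closes; nothing here is about HC.

SETTING.  `S` locally Noetherian (universe `0`, as ★ `AbelianSchemeMulNPullbackClass`), `A/S` an abelian scheme, `c ∈ Ȟ¹(A, 𝒪^×)`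
an ARBITRARY class (no rigidification is assumed: the correction class `π^*ε^*c` is divided out inside the proofs), `T` an
`S`-scheme, `x σ : T → A` points over `S` (elements of the GROUP `Hom_S(T, A)`), `e_T := (1 : T → A)^*c = T^*(ε^*c)` the class of
`L` along the zero point of `A(T)`.

* §1 `pullback_one_left_eq` (`(1_T)^*c = (T → S)^*ε^*c`), `pullback_normalized_*` (the class `c·(π^*ε^*c)⁻¹` is rigidified,
  is symmetric when `c` is, and pulls back to `x^*c · e_T⁻¹` along EVERY point), and
  **`pullback_pow_left_mul_pow` — [MumfordAV1970] §6 Cor. 3 at a point, UNRIGIDIFIED**: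
  `(xⁿ)^*c · e_T^{n²} = (x^*c)^{C(n+1,2)} · ((x⁻¹)^*c)^{C(n,2)} · e_T` (from ★ `pullback_pow_left_eq` for the normalised
  class); `pullback_pow_left_mul_pow_of_symm` — `(xⁿ)^*c · e_T^{n²} = (x^*c)^{n²} · e_T` for `ι^*c = c`.
* §2 **TORSION POINTS** (`σ^N = 1`): `pullback_pow_eq_pullback_inv_pow_of_pow_eq_one` (`(σ^*c)^N = ((σ⁻¹)^*c)^N`),
  **`pullback_pow_eq_of_pow_eq_one` — `(σ^*c)^{2N²} = e_T^{2N²}` for EVERY class `c`** (no symmetry), and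
  **`pullback_pow_eq_of_pow_eq_one_of_symm` — `(σ^*c)^{N²} = e_T^{N²}` for symmetric `c`** (Cor. 3 «`n_X^*L ≅ L^{n²}` if
  `L` is symmetric» read at `σ` with `[N]∘σ = ε`; the torsion-kills-the-label step of [MumfordFogartyKirwan1994] Ch. 7 §3, where the
  `N^{2g}` marked points `σ_a` of a level-`N` structure are compared through ONE line bundle).
* §3 **MODULE FORMS** for a line bundle `L` on `A` (`HasRank L 1`; rank-one modules are classified by their classes, ★
  `nonempty_iso_iff_detClass_eq`, `detClass_tensorPow`, `detClass_pullback`): `nonempty_tensorPow_pullback_iso_of_pow_eq_one`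
  (`(σ^*L)^{⊗2N²} ≅ (e^*L)^{⊗2N²}`, any `L`), `nonempty_tensorPow_pullback_iso_of_pow_eq_one_of_symm` /
  `…_of_symm'` (`(σ^*L)^{⊗N²} ≅ (e^*L)^{⊗N²}` for `[ι^*L] = [L]`, resp. `ι^*L ≅ L`), and the SECTION forms
  `nonempty_tensorPow_pullback_section_iso_of_pow_eq_one(_of_symm)` (`T = S`, `σ ∈ A(S)`, `e = ε` the zero section).

## References
* [MumfordAV1970] D. Mumford, *Abelian Varieties* (1970), §6 Cor. 3 (p. 59), Cor. 4 (p. 59–60).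
* [MumfordFogartyKirwan1994] D. Mumford, J. Fogarty, F. Kirwan, *Geometric Invariant Theory*, 3rd ed. (1994), Ch. 6 §1
  Definition 6.1 (p. 115), §2 Definition 6.2 (p. 120); Ch. 7 §3 Proposition 7.7 (pp. 138–139).
* [Hartshorne1977] R. Hartshorne, *Algebraic Geometry* (1977), II Ex. 6.8 (a), Prop. 6.12 (p. 143), III Ex. 4.5.
-/

set_option autoImplicit false

noncomputable section

set_option backward.isDefEq.respectTransparency false

open CategoryTheory CategoryTheory.Limits AlgebraicGeometry MonoidalCategory CartesianMonoidalCategory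
open scoped MonObj

namespace Literature.AlgebraicGeometry.AbelianSchemes

open Literature.AlgebraicGeometry.Motives Literature.AlgebraicGeometry.Modules
  Literature.AlgebraicGeometry.AbelianVarieties

namespace AbelianSchemeOver

/-! ## §0 Exponent and group bookkeeping -/

/-- `C(n+1, 2) = n + C(n, 2)` (Pascal). [folklore] -/
private theorem choose_two_succ' (n : ℕ) : (n + 1).choose 2 = n + n.choose 2 := by
  rw [Nat.choose_succ_succ, Nat.choose_one_right]

/-- `C(n+1, 2) + C(n, 2) = n²`. [folklore] -/
private theorem choose_two_succ_add_choose_two' (n : ℕ) : (n + 1).choose 2 + n.choose 2 = n ^ 2 := by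
  induction n with
  | zero => simp
  | succ n ih =>
    rw [choose_two_succ' (n + 1)]
    rw [choose_two_succ' n] at ih ⊢
    have hsq : (n + 1) ^ 2 = n ^ 2 + 2 * n + 1 := by ring
    omega

/-- In a commutative group: from `a^{C(N+1,2)}·b^{C(N,2)} = 1` and `b^{C(N+1,2)}·a^{C(N,2)} = 1`, `a^N = b^N`. [folklore] -/
private theorem pow_eq_pow_of_choose_rel {G : Type*} [CommGroup G] {a b : G} {N : ℕ}
    (h1 : a ^ (N + 1).choose 2 * b ^ N.choose 2 = 1) (h2 : b ^ (N + 1).choose 2 * a ^ N.choose 2 = 1) :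
    a ^ N = b ^ N := by
  rw [choose_two_succ', pow_add, mul_assoc] at h1 h2
  rw [mul_comm (b ^ N.choose 2) (a ^ N.choose 2)] at h2
  rw [← h2] at h1
  exact mul_right_cancel h1

/-- In a commutative group: from `a^{C(N+1,2)}·b^{C(N,2)} = 1` and `b^{C(N+1,2)}·a^{C(N,2)} = 1`, `(a·b)^{N²} = 1`. [folklore] -/
private theorem mul_pow_sq_eq_one_of_choose_rel {G : Type*} [CommGroup G] {a b : G} {N : ℕ}
    (h1 : a ^ (N + 1).choose 2 * b ^ N.choose 2 = 1) (h2 : b ^ (N + 1).choose 2 * a ^ N.choose 2 = 1) :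
    (a * b) ^ (N ^ 2) = 1 := by
  rw [← choose_two_succ_add_choose_two' N, pow_add, mul_pow, mul_pow]
  calc (a ^ (N + 1).choose 2 * b ^ (N + 1).choose 2) * (a ^ N.choose 2 * b ^ N.choose 2)
      = (a ^ (N + 1).choose 2 * b ^ N.choose 2) * (b ^ (N + 1).choose 2 * a ^ N.choose 2) := by
        simp only [mul_assoc, mul_comm, mul_left_comm]
    _ = 1 := by rw [h1, h2, mul_one]

/-- In a commutative group: from `a^{C(N+1,2)}·b^{C(N,2)} = 1` and `b^{C(N+1,2)}·a^{C(N,2)} = 1`, `a^{2N²} = 1`. [folklore] -/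
private theorem pow_two_mul_sq_eq_one_of_choose_rel {G : Type*} [CommGroup G] {a b : G} {N : ℕ}
    (h1 : a ^ (N + 1).choose 2 * b ^ N.choose 2 = 1) (h2 : b ^ (N + 1).choose 2 * a ^ N.choose 2 = 1) :
    a ^ (2 * N ^ 2) = 1 := by
  have hab := pow_eq_pow_of_choose_rel h1 h2
  have habN := mul_pow_sq_eq_one_of_choose_rel h1 h2
  calc a ^ (2 * N ^ 2) = a ^ (N ^ 2) * (a ^ N) ^ N := by rw [← pow_mul, ← pow_add]; congr 1; ring
    _ = a ^ (N ^ 2) * (b ^ N) ^ N := by rw [hab]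
    _ = (a * b) ^ (N ^ 2) := by rw [← pow_mul, mul_pow]; congr 2; ring
    _ = 1 := habN

/-- In a commutative group: `(a·e⁻¹)^k = 1 ↔ a^k = e^k`. [folklore] -/
private theorem mul_inv_pow_eq_one_iff {G : Type*} [CommGroup G] (a e : G) (k : ℕ) :
    (a * e⁻¹) ^ k = 1 ↔ a ^ k = e ^ k := by
  rw [mul_pow, inv_pow, mul_inv_eq_one]

variable {S : Scheme.{0}} [IsLocallyNoetherian S] (A : AbelianSchemeOver S) (c : CechPic A.left)

/-! ## §1 The class along the zero point, the normalised class, and Mumford's Cor. 3 unrigidified -/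

omit [IsLocallyNoetherian S] in
/-- **`(1_T)^*c = (T → S)^*(ε^*c)`**: the unit point `1 : T → A` of the group `A(T)` is `T → S --ε--> A`.
[cite: MumfordFogartyKirwan1994, Ch. 6 §1 Definition 6.1 (p. 115)] -/
theorem pullback_one_left_eq {T : Over S} :
    CechPic.pullback (1 : T ⟶ A.X).left c = CechPic.pullback T.hom (CechPic.pullback A.unitSection c) := by
  rw [Hom.one_def, Over.comp_left, CechPic.pullback_comp]
  rfl

omit [IsLocallyNoetherian S] in
/-- **The normalised class `c · (π^*ε^*c)⁻¹` pulls back to `x^*c · ((1_T)^*c)⁻¹` along EVERY point `x : T → A`** (`π ∘ x = (T → S)`).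
[cite: MumfordFogartyKirwan1994, Ch. 6 §2 (p. 120–121)] -/
theorem pullback_normalized {T : Over S} (x : T ⟶ A.X) :
    CechPic.pullback x.left (c * (CechPic.pullback A.X.hom (CechPic.pullback A.unitSection c))⁻¹) =
      CechPic.pullback x.left c * (CechPic.pullback (1 : T ⟶ A.X).left c)⁻¹ := by
  rw [map_mul, map_inv, ← CechPic.pullback_comp, Over.w x, pullback_one_left_eq]

omit [IsLocallyNoetherian S] in
/-- **The normalised class `c · (π^*ε^*c)⁻¹` is rigidified along the zero section** (`ε^*` of it is `1`, as `π ∘ ε = 1_S`).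
[cite: MumfordFogartyKirwan1994, Ch. 6 §2 (p. 120–121)] -/
theorem pullback_unitSection_normalized :
    CechPic.pullback A.unitSection (c * (CechPic.pullback A.X.hom (CechPic.pullback A.unitSection c))⁻¹) = 1 := by
  rw [map_mul, map_inv, ← CechPic.pullback_comp, A.unitSection_comp_hom, CechPic.pullback_id_apply, mul_inv_cancel]

omit [IsLocallyNoetherian S] in
/-- **The normalised class of a SYMMETRIC class is symmetric** (`ι^*(c·(π^*ε^*c)⁻¹) = c·(π^*ε^*c)⁻¹` when `ι^*c = c`, as `π ∘ ι = π`).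
[cite: MumfordAV1970, §6 Cor. 3 (p. 59)] -/
theorem pullback_inv_normalized (hsymm : CechPic.pullback (ι[A.X]).left c = c) :
    CechPic.pullback (ι[A.X]).left (c * (CechPic.pullback A.X.hom (CechPic.pullback A.unitSection c))⁻¹) =
      c * (CechPic.pullback A.X.hom (CechPic.pullback A.unitSection c))⁻¹ := by
  rw [map_mul, map_inv, ← CechPic.pullback_comp, Over.w (ι[A.X]), hsymm]

omit [IsLocallyNoetherian S] in
/-- **Symmetry at a point**: if `ι^*c = c` then `(x⁻¹)^*c = x^*c` for every point `x : T → A` (`x⁻¹ = ι ∘ x`).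
[cite: MumfordAV1970, §6 Cor. 3 (p. 59)] -/
theorem pullback_inv_left_eq_of_symm (hsymm : CechPic.pullback (ι[A.X]).left c = c) {T : Over S} (x : T ⟶ A.X) :
    CechPic.pullback x⁻¹.left c = CechPic.pullback x.left c := by
  rw [Hom.inv_def, Over.comp_left, CechPic.pullback_comp, hsymm]

/-- **[MumfordAV1970] §6 COR. 3 over a locally Noetherian base, at every point, WITHOUT rigidification**: for ANY class
`c ∈ Ȟ¹(A, 𝒪^×)`, every `S`-scheme `T` and every point `x : T → A`,
`(xⁿ)^*c · e_T^{n²} = (x^*c)^{C(n+1,2)} · ((x⁻¹)^*c)^{C(n,2)} · e_T` in `Ȟ¹(T, 𝒪^×)`, where `e_T = (1_T)^*c = (T → S)^*ε^*c`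
(★ `pullback_pow_left_eq` «`n^*L ≅ L^{(n²+n)/2} ⊗ (-1)^*L^{(n²-n)/2}`» for the normalised class `c·(π^*ε^*c)⁻¹`, which is rigidified;
`C(n+1,2) + C(n,2) = n²`). [cite: MumfordAV1970, §6 Cor. 3 (p. 59)] -/
theorem pullback_pow_left_mul_pow {T : Over S} (x : T ⟶ A.X) (n : ℕ) :
    CechPic.pullback (x ^ n).left c * CechPic.pullback (1 : T ⟶ A.X).left c ^ (n ^ 2) =
      CechPic.pullback x.left c ^ (n + 1).choose 2 * CechPic.pullback x⁻¹.left c ^ n.choose 2 *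
        CechPic.pullback (1 : T ⟶ A.X).left c := by
  have key := A.pullback_pow_left_eq _ (A.pullback_unitSection_normalized c) x n
  rw [A.pullback_normalized c (x ^ n), A.pullback_normalized c x, A.pullback_normalized c x⁻¹, mul_pow, mul_pow,
    mul_mul_mul_comm, ← pow_add, choose_two_succ_add_choose_two', inv_pow, mul_inv_eq_iff_eq_mul] at key
  rw [key, mul_assoc, mul_assoc, mul_left_comm (_ ^ (n ^ 2))⁻¹, inv_mul_cancel, mul_one]

/-- **The SYMMETRIC case, unrigidified**: if `ι^*c = c` then `(xⁿ)^*c · e_T^{n²} = (x^*c)^{n²} · e_T` for every point `x : T → A`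
(«in particular `n_X^*L ≅ L^{n²}` if `L` is symmetric», read at `x`, the correction `e_T = (T → S)^*ε^*c` accounting for the
missing rigidification). [cite: MumfordAV1970, §6 Cor. 3 (p. 59)] -/
theorem pullback_pow_left_mul_pow_of_symm (hsymm : CechPic.pullback (ι[A.X]).left c = c) {T : Over S} (x : T ⟶ A.X)
    (n : ℕ) :
    CechPic.pullback (x ^ n).left c * CechPic.pullback (1 : T ⟶ A.X).left c ^ (n ^ 2) =
      CechPic.pullback x.left c ^ (n ^ 2) * CechPic.pullback (1 : T ⟶ A.X).left c := by
  rw [A.pullback_pow_left_mul_pow c x n, A.pullback_inv_left_eq_of_symm c hsymm x, ← pow_add,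
    choose_two_succ_add_choose_two']

/-! ## §2 Torsion points: `(σ^*c)^{2N²} = e_T^{2N²}`, and `(σ^*c)^{N²} = e_T^{N²}` for symmetric `c` -/

/-- The two Cor.-3 relations at an `N`-torsion point `σ` and at `σ⁻¹`, for the NORMALISED classes `a = σ^*c·e_T⁻¹`,
`b = (σ⁻¹)^*c·e_T⁻¹`: `a^{C(N+1,2)}·b^{C(N,2)} = 1` (the left-hand side is `(σ^N)^*` of the normalised class, and `σ^N = 1`).
[cite: MumfordAV1970, §6 Cor. 3 (p. 59)] -/
private theorem normalized_rel_of_pow_eq_one {T : Over S} (σ : T ⟶ A.X) {N : ℕ} (hσ : σ ^ N = 1) :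
    (CechPic.pullback σ.left c * (CechPic.pullback (1 : T ⟶ A.X).left c)⁻¹) ^ (N + 1).choose 2 *
        (CechPic.pullback σ⁻¹.left c * (CechPic.pullback (1 : T ⟶ A.X).left c)⁻¹) ^ N.choose 2 = 1 := by
  have key := A.pullback_pow_left_eq _ (A.pullback_unitSection_normalized c) σ N
  rw [hσ, A.pullback_one_left _ (A.pullback_unitSection_normalized c), A.pullback_normalized c σ,
    A.pullback_normalized c σ⁻¹] at key
  exact key.symm

/-- **At an `N`-torsion point, `(σ^*c)^N = ((σ⁻¹)^*c)^N`** for every class `c` (Cor. 3 at `σ` and at `σ⁻¹`: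
`C(N+1,2) − C(N,2) = N`). [cite: MumfordAV1970, §6 Cor. 3 (p. 59)] -/
theorem pullback_pow_eq_pullback_inv_pow_of_pow_eq_one {T : Over S} (σ : T ⟶ A.X) {N : ℕ} (hσ : σ ^ N = 1) :
    CechPic.pullback σ.left c ^ N = CechPic.pullback σ⁻¹.left c ^ N := by
  have h1 := A.normalized_rel_of_pow_eq_one c σ hσ
  have h2 := A.normalized_rel_of_pow_eq_one c σ⁻¹ (by rw [inv_pow, hσ, inv_one])
  rw [inv_inv] at h2
  have h := pow_eq_pow_of_choose_rel h1 h2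
  rwa [mul_pow, mul_pow, mul_left_inj] at h

/-- **At an `N`-torsion point `σ : T → A`, `(σ^*c)^{2N²} = e_T^{2N²}` in `Ȟ¹(T, 𝒪^×)` for EVERY class `c ∈ Ȟ¹(A, 𝒪^×)`**
(`e_T = (1_T)^*c = (T → S)^*ε^*c`; NO symmetry, NO rigidification: Cor. 3 at `σ` and `σ⁻¹` gives `(a·b)^{N²} = 1` and `a^N = b^N`
for the normalised classes, whence `a^{2N²} = 1`). [cite: MumfordAV1970, §6 Cor. 3 (p. 59)]
[cite: MumfordFogartyKirwan1994, Ch. 7 §3 Proposition 7.7 (pp. 138–139)] -/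
theorem pullback_pow_eq_of_pow_eq_one {T : Over S} (σ : T ⟶ A.X) {N : ℕ} (hσ : σ ^ N = 1) :
    CechPic.pullback σ.left c ^ (2 * N ^ 2) = CechPic.pullback (1 : T ⟶ A.X).left c ^ (2 * N ^ 2) := by
  have h1 := A.normalized_rel_of_pow_eq_one c σ hσ
  have h2 := A.normalized_rel_of_pow_eq_one c σ⁻¹ (by rw [inv_pow, hσ, inv_one])
  rw [inv_inv] at h2
  exact (mul_inv_pow_eq_one_iff _ _ _).mp (pow_two_mul_sq_eq_one_of_choose_rel h1 h2)

/-- **At an `N`-torsion point `σ : T → A`, `(σ^*c)^{N²} = e_T^{N²}` for a SYMMETRIC class `c`** (`ι^*c = c`; `e_T = (1_T)^*c =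
(T → S)^*ε^*c`): Cor. 3 «`n_X^*L ≅ L^{n²}` if `L` is symmetric» read at `σ`, `(σ^*L)^{N²} ≅ ([N]∘σ)^*L = ε_T^*L` up to the
(absent) rigidification, which the two sides `e_T` account for. [cite: MumfordAV1970, §6 Cor. 3 (p. 59)]
[cite: MumfordFogartyKirwan1994, Ch. 7 §3 Proposition 7.7 (pp. 138–139)] -/
theorem pullback_pow_eq_of_pow_eq_one_of_symm (hsymm : CechPic.pullback (ι[A.X]).left c = c) {T : Over S} (σ : T ⟶ A.X)
    {N : ℕ} (hσ : σ ^ N = 1) :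
    CechPic.pullback σ.left c ^ (N ^ 2) = CechPic.pullback (1 : T ⟶ A.X).left c ^ (N ^ 2) := by
  have h1 := A.normalized_rel_of_pow_eq_one c σ hσ
  rw [A.pullback_inv_left_eq_of_symm c hsymm σ, ← pow_add, choose_two_succ_add_choose_two'] at h1
  exact (mul_inv_pow_eq_one_iff _ _ _).mp h1

/-- The same for a SECTION `σ ∈ A(S)` (`T = S`): `(σ^*c)^{N²} = (ε^*c)^{N²}` with `ε` the zero section.
[cite: MumfordAV1970, §6 Cor. 3 (p. 59)] -/
theorem pullback_section_pow_eq_of_pow_eq_one_of_symm (hsymm : CechPic.pullback (ι[A.X]).left c = c) (σ : A.Sections)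
    {N : ℕ} (hσ : σ ^ N = 1) :
    CechPic.pullback σ.left c ^ (N ^ 2) = CechPic.pullback A.unitSection c ^ (N ^ 2) := by
  rw [A.pullback_pow_eq_of_pow_eq_one_of_symm c hsymm σ hσ, pullback_one_left_eq]
  change CechPic.pullback (𝟙 S) _ ^ _ = _
  rw [CechPic.pullback_id_apply]

/-- The same for a SECTION `σ ∈ A(S)` and ANY class: `(σ^*c)^{2N²} = (ε^*c)^{2N²}`. [cite: MumfordAV1970, §6 Cor. 3 (p. 59)] -/
theorem pullback_section_pow_eq_of_pow_eq_one (σ : A.Sections) {N : ℕ} (hσ : σ ^ N = 1) :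
    CechPic.pullback σ.left c ^ (2 * N ^ 2) = CechPic.pullback A.unitSection c ^ (2 * N ^ 2) := by
  rw [A.pullback_pow_eq_of_pow_eq_one c σ hσ, pullback_one_left_eq]
  change CechPic.pullback (𝟙 S) _ ^ _ = _
  rw [CechPic.pullback_id_apply]

/-! ## §3 Module forms: `(σ^*L)^{⊗N²} ≅ (e^*L)^{⊗N²}` for a symmetric line bundle, `(σ^*L)^{⊗2N²} ≅ (e^*L)^{⊗2N²}` always -/

section Modules

variable {A} {L : A.left.Modules} (hL : HasRank L 1)

omit [IsLocallyNoetherian S] in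
/-- Class bookkeeping: two tensor powers of pull-backs of a line bundle are isomorphic as soon as the corresponding powers of
the pulled-back classes agree (★ `nonempty_iso_iff_detClass_eq`, `detClass_tensorPow`, `detClass_pullback`).
[cite: Hartshorne1977, II Ex. 6.8 (a), Prop. 6.12 (p. 143) and III Ex. 4.5] -/
theorem nonempty_tensorPow_pullback_iso_of_detClass_pow_eq {Y : Scheme.{0}} (f g : Y ⟶ A.left) (k : ℕ)
    (h : CechPic.pullback f (detClass (HasRank.isFiniteLocallyFree' hL)) ^ k =
      CechPic.pullback g (detClass (HasRank.isFiniteLocallyFree' hL)) ^ k) :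
    Nonempty (tensorPow ((Scheme.Modules.pullback f).obj L) k ≅ tensorPow ((Scheme.Modules.pullback g).obj L) k) := by
  have hL₁ := HasRank.isFiniteLocallyFree' hL
  rw [nonempty_iso_iff_detClass_eq (hasRank_tensorPow_one (hasRank_pullback f hL) k)
    (hasRank_tensorPow_one (hasRank_pullback g hL) k) (isFiniteLocallyFree_tensorPow (hL₁.pullback f) k)
    (isFiniteLocallyFree_tensorPow (hL₁.pullback g) k),
    detClass_tensorPow (hasRank_pullback f hL) (hL₁.pullback f) k, detClass_tensorPow (hasRank_pullback g hL) (hL₁.pullback g) k,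
    detClass_pullback f hL₁, detClass_pullback g hL₁]
  exact h

include hL in
/-- **`(σ^*L)^{⊗2N²} ≅ (e^*L)^{⊗2N²}` for EVERY line bundle `L` on `A` and every `N`-torsion point `σ : T → A`** (`e = 1_T : T → A`
the zero point; no symmetry, no rigidification). [cite: MumfordAV1970, §6 Cor. 3 (p. 59)]
[cite: MumfordFogartyKirwan1994, Ch. 7 §3 Proposition 7.7 (pp. 138–139)] -/
theorem nonempty_tensorPow_pullback_iso_of_pow_eq_one {T : Over S} (σ : T ⟶ A.X) {N : ℕ} (hσ : σ ^ N = 1) :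
    Nonempty (tensorPow ((Scheme.Modules.pullback σ.left).obj L) (2 * N ^ 2) ≅
      tensorPow ((Scheme.Modules.pullback (1 : T ⟶ A.X).left).obj L) (2 * N ^ 2)) :=
  nonempty_tensorPow_pullback_iso_of_detClass_pow_eq hL _ _ _ (A.pullback_pow_eq_of_pow_eq_one _ σ hσ)

/-- **`(σ^*L)^{⊗N²} ≅ (e^*L)^{⊗N²}` for a line bundle `L` on `A` with SYMMETRIC CLASS (`ι^*[L] = [L]`) and every `N`-torsion point
`σ : T → A`** (`e = 1_T` the zero point; Cor. 3 «`n_X^*L ≅ L^{n²}` if `L` is symmetric» at `σ`, `[N]∘σ = ε_T`).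
[cite: MumfordAV1970, §6 Cor. 3 (p. 59)] [cite: MumfordFogartyKirwan1994, Ch. 7 §3 Proposition 7.7 (pp. 138–139)] -/
theorem nonempty_tensorPow_pullback_iso_of_pow_eq_one_of_symm
    (hsymm : CechPic.pullback (ι[A.X]).left (detClass (HasRank.isFiniteLocallyFree' hL)) =
      detClass (HasRank.isFiniteLocallyFree' hL))
    {T : Over S} (σ : T ⟶ A.X) {N : ℕ} (hσ : σ ^ N = 1) :
    Nonempty (tensorPow ((Scheme.Modules.pullback σ.left).obj L) (N ^ 2) ≅
      tensorPow ((Scheme.Modules.pullback (1 : T ⟶ A.X).left).obj L) (N ^ 2)) :=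
  nonempty_tensorPow_pullback_iso_of_detClass_pow_eq hL _ _ _ (A.pullback_pow_eq_of_pow_eq_one_of_symm _ hsymm σ hσ)

omit [IsLocallyNoetherian S] in
/-- A symmetric line bundle (`ι^*L ≅ L`) has symmetric class (`ι^*[L] = [L]`). [cite: Hartshorne1977, II Ex. 6.8 (a) and III Ex. 4.5] -/
theorem pullback_inv_detClass_eq_of_iso (hι : Nonempty ((Scheme.Modules.pullback (ι[A.X]).left).obj L ≅ L)) :
    CechPic.pullback (ι[A.X]).left (detClass (HasRank.isFiniteLocallyFree' hL)) = detClass (HasRank.isFiniteLocallyFree' hL) := by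
  obtain ⟨φ⟩ := hι
  rw [← detClass_pullback (ι[A.X]).left (HasRank.isFiniteLocallyFree' hL)]
  exact detClass_eq_of_iso φ _ _

include hL in
/-- **`(σ^*L)^{⊗N²} ≅ (e^*L)^{⊗N²}` for a SYMMETRIC line bundle (`ι^*L ≅ L`) and an `N`-torsion point `σ : T → A`.**
[cite: MumfordAV1970, §6 Cor. 3 (p. 59)] [cite: Hartshorne1977, II Prop. 6.12 (p. 143) and III Ex. 4.5] -/
theorem nonempty_tensorPow_pullback_iso_of_pow_eq_one_of_symm'
    (hι : Nonempty ((Scheme.Modules.pullback (ι[A.X]).left).obj L ≅ L)) {T : Over S} (σ : T ⟶ A.X) {N : ℕ} (hσ : σ ^ N = 1) :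
    Nonempty (tensorPow ((Scheme.Modules.pullback σ.left).obj L) (N ^ 2) ≅
      tensorPow ((Scheme.Modules.pullback (1 : T ⟶ A.X).left).obj L) (N ^ 2)) :=
  nonempty_tensorPow_pullback_iso_of_pow_eq_one_of_symm hL (pullback_inv_detClass_eq_of_iso hL hι) σ hσ

/-- **SECTION form: `(σ^*L)^{⊗N²} ≅ (ε^*L)^{⊗N²}` for a section `σ ∈ A(S)` of order `N` and a line bundle with symmetric class**
(`ε : S → A` the zero section). [cite: MumfordAV1970, §6 Cor. 3 (p. 59)] [cite: Hartshorne1977, II Prop. 6.12 (p. 143) and III Ex. 4.5] -/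
theorem nonempty_tensorPow_pullback_section_iso_of_pow_eq_one_of_symm
    (hsymm : CechPic.pullback (ι[A.X]).left (detClass (HasRank.isFiniteLocallyFree' hL)) =
      detClass (HasRank.isFiniteLocallyFree' hL))
    (σ : A.Sections) {N : ℕ} (hσ : σ ^ N = 1) :
    Nonempty (tensorPow ((Scheme.Modules.pullback σ.left).obj L) (N ^ 2) ≅
      tensorPow ((Scheme.Modules.pullback A.unitSection).obj L) (N ^ 2)) :=
  nonempty_tensorPow_pullback_iso_of_detClass_pow_eq hL _ _ _ (A.pullback_section_pow_eq_of_pow_eq_one_of_symm _ hsymm σ hσ)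

include hL in
/-- **SECTION form, any line bundle: `(σ^*L)^{⊗2N²} ≅ (ε^*L)^{⊗2N²}` for a section `σ ∈ A(S)` of order `N`.**
[cite: MumfordAV1970, §6 Cor. 3 (p. 59)] -/
theorem nonempty_tensorPow_pullback_section_iso_of_pow_eq_one (σ : A.Sections) {N : ℕ} (hσ : σ ^ N = 1) :
    Nonempty (tensorPow ((Scheme.Modules.pullback σ.left).obj L) (2 * N ^ 2) ≅
      tensorPow ((Scheme.Modules.pullback A.unitSection).obj L) (2 * N ^ 2)) :=
  nonempty_tensorPow_pullback_iso_of_detClass_pow_eq hL _ _ _ (A.pullback_section_pow_eq_of_pow_eq_one _ σ hσ)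

end Modules

end AbelianSchemeOver

end Literature.AlgebraicGeometry.AbelianSchemes

end
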